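import Literature.NumberTheory.Weil1964.ArchFollandDualPair
import Literature.NumberTheory.Weil1964.ArchVacuumSectionPlaces
import Literature.NumberTheory.Weil1964.ArchFollandCoordinates
import HarnessLib

/-!
# The archimedean action of ONE adelic unitary group `U(J)(𝔸_F) ⊂ Sp(𝕎_𝔸)` in the scaled Folland frame =
# place by place Konno–Konno's `U(P_v, Q_v) ↪ Sp` (`UForm.toSp`), and `U(J)(F ⊗ ℝ)` fixes the finite vectors

Topic `NumberTheory/Weil1964`; namespace `Literature.NumberTheory.Weil1964`.  KERNEL MATHEMATICS ONLY: one transparent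
abbreviation (`placeScale`) and proved theorems; no `def … : Prop` record, no axiom, no proof hole.

The SINGLE-GROUP twin of `ArchFollandDualPair.archFolland_archAct_toSp_pair_slice` / `ArchDualPairThetaMajorants.archPhaseMap_toSp_pair`
(which treat the PAIR `U(J_V) × U(J_W) ↪ Sp(Res(V ⊗ W))`).  For ONE unitary group `U(J)(𝔸_F)` of a DIAGONAL
`F`-rational hermitian form `J = diag(t₀) ⊗ 1` over a CM-type quadratic extension `E/F` of a totally real `F`, embedded by
restriction of scalars `ι_𝔸 = UnitaryGroup.adelicToSymplectic : U(J)(𝔸_F) → Sp(𝔸_Fᴺ × 𝔸_Fᴺ)`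
([GelbartRogawski1991] §3.1 `G(𝐀) ⊂ Sp_𝐀(W)`):

* §1 `archFolland_archAct_adelicToSymplectic_slice`, **`archPhaseMap_adelicToSymplectic`** — THE DICTIONARY: in the
  scaled Folland frame `e_D` of `𝕎_∞ = ⊕_v 𝕎_v` (`ArchFollandTorusAdelic.scaledFrame`, scaling adapted place by place,
  `σ_v(t₀ j) = c_v ε_{v,j} D_{v,j}²` with `c_v = im σ_{w(v)}(δ)`), the Folland-coordinate phase map of `ι_𝔸(u)` is
  `placePhase (v ↦ reindexPhase ε_v ⇑(toSp (archUForm v u)))`: place by place, up to the sign-sorting relabelling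
  `ε_v : Fin N ≃ P_v ⊕ Q_v`, it is Konno–Konno's standard embedding `UForm.toSp : U(P_v,Q_v) → Sp(ℝ^{P⊕Q} × ℝ^{P⊕Q})`
  ([KonnoKonno2007] §3.1, [MoeglinVignerasWaldspurger1987] Ch. 1 I.17, [Folland1989] Prop. (4.6)) of the Sylvester
  image `archUForm v u` of the `w(v)`-component of `u` (`ArchFollandDualPair.archUForm`, continuous homomorphism);
* §2 **`adelicToSymplectic_archToAdelic_finVec`** — for an ARCHIMEDEAN element `u = (g, 1) = archToAdelic g`,
  `ι_𝔸(u)` FIXES the finite vectors `((0, k), (0, c))` of `𝔸_Fᴺ × 𝔸_Fᴺ` (the hypothesis `hg` of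
  `AdelicMetaplecticOfArchImplementer.archElt`); twin of `UnitaryGroupSymplecticLocalization.fst_adelicToSymplectic_finAdelicToAdelic_apply`.

## References

* [GelbartRogawski1991] S. Gelbart, J. Rogawski, Invent. math. 105 (1991), §3.1 p. 454.
* [KonnoKonno2007] K. Konno, T. Konno, Kyushu J. Math. 61 (2007), §3.1 (3.1).
* [MoeglinVignerasWaldspurger1987] C. Mœglin, M.-F. Vignéras, J.-L. Waldspurger, LNM 1291 (1987), Ch. 1 I.17.
* [Folland1989] G. B. Folland, *Harmonic Analysis in Phase Space*, Princeton UP 1989, Ch. 4 §1 Prop. (4.6), §1.3 (1.25).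
* [BorelJacquet1979] A. Borel, H. Jacquet, PSPM 33.1 (1979), §4.1.
-/

set_option autoImplicit false

open scoped Matrix Real Classical ComplexConjugate
open Complex NumberField NumberField.InfinitePlace NumberField.mixedEmbedding IsDedekindDomain
open Literature.NumberTheory.Automorphic Literature.NumberTheory.Automorphic.UnitaryGroup
open Literature.RepresentationTheory.HeisenbergGroup Literature.Analysis.SegalBargmann
open Literature.RepresentationTheory.KonnoKonno2007 Literature.RepresentationTheory.KonnoKonno2007.RealDualPair

noncomputable section

namespace Literature.NumberTheory.Weil1964

local notation "PV" σ => (σ → ℝ) × (σ → ℝ)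

/-! ## §1 The dictionary at every real place -/

section Dictionary

variable {F : Type} [Field F] [NumberField F] (E : Type) [Field E] [NumberField E] [Algebra F E] (c : E ≃ₐ[F] E)
  (N : ℕ) (hc : c ≠ 1)
  (wOf : {v : InfinitePlace F // v.IsReal} → {w : InfinitePlace E // w.IsComplex})
  (hw : ∀ v, c • (wOf v).1 = (wOf v).1) (hover : ∀ v, (wOf v).1.comap (algebraMap F E) = v.1)
  (t₀ : Fin N → F) {J : Matrix (Fin N) (Fin N) E} (hJ : J = (Matrix.diagonal t₀).map (algebraMap F E))
  {P Q : {v : InfinitePlace F // v.IsReal} → Type*} [∀ v, Fintype (P v)] [∀ v, DecidableEq (P v)]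
  [∀ v, Fintype (Q v)] [∀ v, DecidableEq (Q v)] (ε : ∀ v, Fin N ≃ P v ⊕ Q v)
  {D : {v : InfinitePlace F // v.IsReal} → Fin N → ℝ} (hD0 : ∀ v j, D v j ≠ 0)
  {c' : {v : InfinitePlace F // v.IsReal} → ℝ} (hc' : ∀ v, c' v ≠ 0)
  (ht : ∀ v j, embedding_of_isReal v.2 (t₀ j) = c' v * signOf (ε v j) * D v j ^ 2)

/-- **The place-indexed scaling** `D_{(j, v)} = D v j` of the scaled Folland frame of one hermitian space.
[cite: Folland1989, §1.3 (1.25)] -/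
abbrev placeScale (D : {v : InfinitePlace F // v.IsReal} → Fin N → ℝ) :
    Fin N × {v : InfinitePlace F // v.IsReal} → ℝ := fun k => D k.2 k.1

omit [NumberField F] in
/-- `placeScale` does not vanish. [cite: Folland1989, §1.3 (1.25)] -/
theorem placeScale_ne_zero (hD0 : ∀ v j, D v j ≠ 0) : ∀ k, placeScale N D k ≠ 0 := fun _ => hD0 _ _

omit [NumberField F] in
/-- `signOf x * signOf x = 1`. [cite: KonnoKonno2007, §3.1] -/
theorem signOf_mul_self {α β : Type*} (x : α ⊕ β) : signOf x * signOf x = 1 := by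
  rcases signOf_eq_one_or x with h | h <;> rw [h] <;> norm_num

omit [NumberField F] [NumberField E] [Algebra F E] [∀ v, Fintype (P v)] [∀ v, DecidableEq (P v)]
  [∀ v, Fintype (Q v)] [∀ v, DecidableEq (Q v)] in
include ht in
/-- the adapted condition `im σ_{w(v)}(δ) · D² = ε t` from `σ_v t₀ = c' ε D²` and `c' = im σ_{w(v)}(δ)`.
[cite: Folland1989, Ch. 4 §1, Prop. (4.6) p. 151] -/
theorem adapted_of_ht {δ : E} (hcc : ∀ v, c' v = ((wOf v).1.embedding δ).im)
    (v : {v : InfinitePlace F // v.IsReal}) (j : Fin N) :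
    ((wOf v).1.embedding δ).im * D v j ^ 2 = signOf (ε v j) * embedding_of_isReal v.2 (t₀ j) := by
  rw [ht v j, ← hcc v]
  have h := signOf_mul_self (ε v j)
  linear_combination (-(c' v * D v j ^ 2)) * h

variable [IsTotallyReal F] [Algebra.IsQuadraticExtension F E] {δ : E} (hcδ : c δ = -δ) (hδ : δ ≠ 0) {d : F}
  (hd : δ * δ = algebraMap F E d) (hT : (Matrix.diagonal t₀).IsSymm)

/-- **The dictionary, at one real place `v`.**  For `u ∈ U(J)(𝔸_F)`, `J = diag(t₀) ⊗ 1`, the `v`-slices of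
`Ξ(archAct 𝕋 (ι_𝔸 u) (a, b))` in the scaled Folland frame are `reindexPhase ε_v ⇑(toSp (archUForm v u))` applied to
the `v`-slices of `Ξ(a, b)` — the archimedean action of the adelic unitary group IS, place by place and up to the
sign-sorting relabelling, Konno–Konno's `U(P,Q) ↪ Sp`. [cite: GelbartRogawski1991, §3.1 p. 454; KonnoKonno2007, §3.1 (3.1);
Folland1989, Ch. 4 §1, Prop. (4.6) p. 151] -/
theorem archFolland_archAct_adelicToSymplectic_slice (hcc : ∀ v, c' v = ((wOf v).1.embedding δ).im)
    (v : {v : InfinitePlace F // v.IsReal}) (u : UnitaryGroup.adelic F E c N J) (a b : Fin N → mixedSpace F) :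
    ((fun j => (archFolland ((Matrix.diagonal t₀).map (algebraMap F (AdeleRing (𝓞 F) F)))
          (scaledFrame F (Fin N) (placeScale N D) (placeScale_ne_zero N hD0))
        (archAct ((Matrix.diagonal t₀).map (algebraMap F (AdeleRing (𝓞 F) F)))
          (adelicToSymplectic F E c N hcδ hδ hd hT hJ u) (a, b))).1 (j, v)),
      (fun j => (archFolland ((Matrix.diagonal t₀).map (algebraMap F (AdeleRing (𝓞 F) F)))
          (scaledFrame F (Fin N) (placeScale N D) (placeScale_ne_zero N hD0))
        (archAct ((Matrix.diagonal t₀).map (algebraMap F (AdeleRing (𝓞 F) F)))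
          (adelicToSymplectic F E c N hcδ hδ hd hT hJ u) (a, b))).2 (j, v))) =
      reindexPhase (ε v)
        (⇑((UForm.toSp (P v) (Q v) (archUForm E c N hc wOf hw hover t₀ hJ v (ε v) (hD0 v) (hc' v) (ht v) u)).1 :
          (PV (P v ⊕ Q v)) ≃ₗ[ℝ] PV (P v ⊕ Q v)))
        ((fun j => (archFolland ((Matrix.diagonal t₀).map (algebraMap F (AdeleRing (𝓞 F) F)))
            (scaledFrame F (Fin N) (placeScale N D) (placeScale_ne_zero N hD0)) (a, b)).1 (j, v)),
          (fun j => (archFolland ((Matrix.diagonal t₀).map (algebraMap F (AdeleRing (𝓞 F) F)))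
            (scaledFrame F (Fin N) (placeScale N D) (placeScale_ne_zero N hD0)) (a, b)).2 (j, v))) := by
  set T𝔸 := (Matrix.diagonal t₀).map (algebraMap F (AdeleRing (𝓞 F) F)) with hT𝔸
  set g := adelicToSymplectic F E c N hcδ hδ hd hT hJ u with hg
  rw [show archAct T𝔸 g (a, b) = ((archAct T𝔸 g (a, b)).1, (archAct T𝔸 g (a, b)).2) from rfl,
    archFolland_scaledFrame t₀ rfl, archFolland_scaledFrame t₀ rfl]
  have hslice := placeVec_archAct_adelicToSymplectic F E c N hcδ hδ hc hd hT hJ v (wOf v) (hw v) (hover v) u a b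
  rw [show (placeVec F (Fin N) v (archAct T𝔸 g (a, b)).1, placeVec F (Fin N) v (archAct T𝔸 g (a, b)).2) =
      (isQuadraticCoordinates_complex ((wOf v).1.embedding δ)
          (UnitaryGroup.re_embedding_delta F E c (wOf v) (hw v) hc hcδ)
          (UnitaryGroup.im_embedding_delta_ne_zero F E c (wOf v) (hw v) hc hcδ hδ)).resEnd (Fin N)
        (((archAt F E c N J (wOf v) (hw v) hc (archPart F E c N J u) : archLocal E N J (wOf v)) : GL (Fin N) ℂ) :
          Matrix (Fin N) (Fin N) ℂ)
        (placeVec F (Fin N) v a, placeVec F (Fin N) v b) from hslice]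
  rw [follandScale_resEnd_eq_reindexPhase_twRealify (isQuadraticCoordinates_complex ((wOf v).1.embedding δ) _ _)
    (UnitaryGroup.re_embedding_delta F E c (wOf v) (hw v) hc hcδ) (ε v)
    (t := fun j => embedding_of_isReal v.2 (t₀ j)) (D := fun j => placeScale N D (j, v))
    (fun j => adapted_of_ht (E := E) (N := N) (wOf := wOf) (t₀ := t₀) (ε := ε) (ht := ht) hcc v j) (fun j => hD0 v j)]
  congr 1
  rw [UForm.coe_toSp, coe_archUForm]

/-- **THE DICTIONARY (all real places at once).**  In the scaled Folland frame the archimedean phase map of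
`ι_𝔸(u)`, `u ∈ U(J)(𝔸_F)`, is `placePhase (v ↦ reindexPhase ε_v ⇑(toSp (archUForm v u)))`.
[cite: GelbartRogawski1991, §3.1 p. 454; KonnoKonno2007, §3.1 (3.1); MoeglinVignerasWaldspurger1987, Ch. 1 I.17;
Folland1989, Ch. 4 §1, Prop. (4.6) p. 151] -/
theorem archPhaseMap_adelicToSymplectic (hcc : ∀ v, c' v = ((wOf v).1.embedding δ).im)
    (hTu : IsUnit (archMat F (Fin N) ((Matrix.diagonal t₀).map (algebraMap F (AdeleRing (𝓞 F) F)))))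
    (u : UnitaryGroup.adelic F E c N J) :
    archPhaseMap ((Matrix.diagonal t₀).map (algebraMap F (AdeleRing (𝓞 F) F)))
        (scaledFrame F (Fin N) (placeScale N D) (placeScale_ne_zero N hD0)) hTu
        (adelicToSymplectic F E c N hcδ hδ hd hT hJ u) =
      placePhase fun v => reindexPhase (ε v)
        (⇑((UForm.toSp (P v) (Q v) (archUForm E c N hc wOf hw hover t₀ hJ v (ε v) (hD0 v) (hc' v) (ht v) u)).1 :
          (PV (P v ⊕ Q v)) ≃ₗ[ℝ] PV (P v ⊕ Q v))) := by
  funext pq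
  obtain ⟨⟨a, b⟩, rfl⟩ := (archFolland_bijective (T := (Matrix.diagonal t₀).map (algebraMap F (AdeleRing (𝓞 F) F)))
    (scaledFrame F (Fin N) (placeScale N D) (placeScale_ne_zero N hD0)) hTu).2 pq
  rw [archPhaseMap_archFolland]
  have key := fun v => archFolland_archAct_adelicToSymplectic_slice E c N hc wOf hw hover t₀ hJ ε hD0 hc' ht hcδ hδ hd hT
    hcc v u a b
  refine Prod.ext (funext fun k => ?_) (funext fun k => ?_)
  · obtain ⟨i, v⟩ := k
    rw [placePhase_fst]
    exact congrArg (fun pq : PV (Fin N) => pq.1 i) (key v)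
  · obtain ⟨i, v⟩ := k
    rw [placePhase_snd]
    exact congrArg (fun pq : PV (Fin N) => pq.2 i) (key v)

end Dictionary

/-! ## §2 Archimedean elements fix the finite vectors -/

section FixesFinite

variable (F : Type) [Field F] [NumberField F] (E : Type) [Field E] [NumberField E] [Algebra F E]
  [Algebra.IsQuadraticExtension F E] (c : E ≃ₐ[F] E) (N : ℕ) {δ : E} (hcδ : c δ = -δ) (hδ : δ ≠ 0) {d : F}
  (hd : δ * δ = algebraMap F E d) {T : Matrix (Fin N) (Fin N) F} (hT : T.IsSymm) {J : Matrix (Fin N) (Fin N) E}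
  (hJ : J = T.map (algebraMap F E))

/-- the quadratic coordinate of a finite pair has zero archimedean part: `(Ψ_𝔸 ((0,k), (0,c)))_∞ = 0`.
[cite: BorelJacquet1979, §4.1] -/
theorem fst_quadraticAdeleEquiv_finVec (k c' : Fin N → FiniteAdeleRing (𝓞 F) F) (i : Fin N) :
    (quadraticAdeleEquiv F E c hcδ hδ (piAdeleSplit F (Fin N) (0, k) i, piAdeleSplit F (Fin N) (0, c') i)).1 = 0 := by
  rw [quadraticAdeleEquiv_apply]
  show (AdeleRing.baseChange F E (piAdeleSplit F (Fin N) (0, k) i)).1 +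
    (AdeleRing.baseChange F E (piAdeleSplit F (Fin N) (0, c') i) * algebraMap E (AdeleRing (𝓞 E) E) δ).1 = 0
  have h1 : ∀ x : Fin N → FiniteAdeleRing (𝓞 F) F, (AdeleRing.baseChange F E (piAdeleSplit F (Fin N) (0, x) i)).1 = 0 := fun x => by
    rw [AdeleRing.baseChange_fst]
    have : (piAdeleSplit F (Fin N) (0, x) i).1 = 0 := by
      show ((InfiniteAdeleRing.ringEquiv_mixedSpace F).symm ((0 : Fin N → mixedSpace F) i)) = 0
      rw [Pi.zero_apply, map_zero]
    rw [this, map_zero]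
  have hmul : ∀ x y : AdeleRing (𝓞 E) E, (x * y).1 = x.1 * y.1 := fun _ _ => rfl
  rw [hmul, h1, h1, zero_mul, add_zero]

/-- `ι_𝔸(u)` fixes the finite vectors whenever the matrix of `u` is `(g, 1)`. [cite: BorelJacquet1979, §4.1] -/
theorem adelicToSymplectic_finVec_of_eq_ofInfinite (u : UnitaryGroup.adelic F E c N J) (g : GL (Fin N) (mixedSpace E))
    (hu : (u : GL (Fin N) (AdeleRing (𝓞 E) E)) = GLn.ofInfinite N E g) (k c' : Fin N → FiniteAdeleRing (𝓞 F) F) :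
    (adelicToSymplectic F E c N hcδ hδ hd hT hJ u).1
        (piAdeleSplit F (Fin N) (0, k), piAdeleSplit F (Fin N) (0, c')) =
      (piAdeleSplit F (Fin N) (0, k), piAdeleSplit F (Fin N) (0, c')) := by
  set Ψ := (quadraticAdeleEquiv F E c hcδ hδ).toAddEquiv with hΨ
  obtain ⟨X, hX⟩ : ∃ X, (piAdeleSplit F (Fin N) (0, k), piAdeleSplit F (Fin N) (0, c')) =
      QuadraticCoordinates.reIm Ψ (Fin N) X :=
    ⟨_, ((QuadraticCoordinates.reIm Ψ (Fin N)).apply_symm_apply _).symm⟩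
  have hX1 : ∀ i, (X i).1 = 0 := by
    intro i
    have hi : X i = (QuadraticCoordinates.reIm Ψ (Fin N)).symm
        (piAdeleSplit F (Fin N) (0, k), piAdeleSplit F (Fin N) (0, c')) i := by
      have := congrArg (fun p : (Fin N → AdeleRing (𝓞 F) F) × (Fin N → AdeleRing (𝓞 F) F) =>
        (QuadraticCoordinates.reIm Ψ (Fin N)).symm p i) hX
      rw [AddEquiv.symm_apply_apply] at this
      exact this.symm
    rw [hi]
    exact fst_quadraticAdeleEquiv_finVec F E c N hcδ hδ k c' i
  have hGX : ((u : GL (Fin N) (AdeleRing (𝓞 E) E)) : Matrix (Fin N) (Fin N) (AdeleRing (𝓞 E) E)) *ᵥ X = X := by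
    funext i
    rw [Matrix.mulVec, dotProduct, hu]
    have hG : ∀ j, ((GLn.ofInfinite N E g : GL (Fin N) (AdeleRing (𝓞 E) E)) : Matrix (Fin N) (Fin N) (AdeleRing (𝓞 E) E)) i j =
        ((InfiniteAdeleRing.ringEquiv_mixedSpace E).symm ((g : Matrix (Fin N) (Fin N) (mixedSpace E)) i j),
          (1 : Matrix (Fin N) (Fin N) (FiniteAdeleRing (𝓞 E) E)) i j) := fun j => GLn.coe_ofInfinite_apply g i j
    refine Prod.ext ?_ ?_
    · rw [AdeleRing.fst_sum, hX1]
      refine Finset.sum_eq_zero fun j _ => ?_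
      show (((GLn.ofInfinite N E g : GL (Fin N) (AdeleRing (𝓞 E) E)) : Matrix (Fin N) (Fin N) (AdeleRing (𝓞 E) E)) i j).1 *
        (X j).1 = 0
      rw [hX1, mul_zero]
    · rw [AdeleRing.snd_sum]
      have h2 : ∀ j, ((((GLn.ofInfinite N E g : GL (Fin N) (AdeleRing (𝓞 E) E)) :
          Matrix (Fin N) (Fin N) (AdeleRing (𝓞 E) E)) i j) * X j).2 =
          (1 : Matrix (Fin N) (Fin N) (FiniteAdeleRing (𝓞 E) E)) i j * (X j).2 := fun j => by
        show (((GLn.ofInfinite N E g : GL (Fin N) (AdeleRing (𝓞 E) E)) : Matrix (Fin N) (Fin N) (AdeleRing (𝓞 E) E))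
          i j).2 * (X j).2 = _
        rw [hG j]
      simp only [h2, Matrix.one_apply, ite_mul, one_mul, zero_mul, Finset.sum_ite_eq, Finset.mem_univ, if_true]
  rw [hX, adelicToSymplectic_reIm, hGX]

/-- **`ι_𝔸(g, 1)` FIXES THE FINITE VECTORS**: for `g ∈ U(J)(F ⊗ ℝ)`,
`ι_𝔸(archToAdelic g) ((0,k), (0,c)) = ((0,k), (0,c))` (finite vectors `piAdeleSplit (0, k)`).
[cite: BorelJacquet1979, §4.1; GelbartRogawski1991, §3.1 p. 454] -/
theorem adelicToSymplectic_archToAdelic_finVec (g : UnitaryGroup.arch F E c N J) (k c' : Fin N → FiniteAdeleRing (𝓞 F) F) :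
    (adelicToSymplectic F E c N hcδ hδ hd hT hJ (archToAdelic F E c N J g)).1
        (piAdeleSplit F (Fin N) (0, k), piAdeleSplit F (Fin N) (0, c')) =
      (piAdeleSplit F (Fin N) (0, k), piAdeleSplit F (Fin N) (0, c')) :=
  adelicToSymplectic_finVec_of_eq_ofInfinite F E c N hcδ hδ hd hT hJ (archToAdelic F E c N J g) g.1 rfl k c'

end FixesFinite

end Literature.NumberTheory.Weil1964
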